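import Summits.CriticalPhenomena.PercolationContinuityZ3.Theorems.Transplant.FKConnectivityAllQAntipodalMinorWeightDefs
import Summits.CriticalPhenomena.PercolationContinuityZ3.Theorems.Transplant.FKConnectivityAllQAntipodalMinorGluing
import HarnessLib

/-!
# Connectivity correlation inequalities for `φ_{w,q}`, every `q > 0` — file 23d: series/parallel composition laws of the antipodal
# up-correlation functional with a CONTRACTED SET and a GENERAL LEVEL WEIGHT

Support file (`--supports stmt-CriticalPhenomena-4575`), FK sub-lane `prim-bschramm-fk-2` (gen 21); builds on p205010 (kernel theorem,
internal audit signed; external expert review pending).  No definitions, no named facts, no sorries; standard axioms.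

THE OBJECT (`…AntipodalMinorWeightDefs.lean`): `apUpcCLW w M C s t h = ∑_{γ ⊆ M} w(k(γ∪C)+k((M\γ)∪C)) (1{s↔t in γ∪C} - 1{s↔t in (M\γ)∪C}) h(γ)`.
This file is gen 11's `…AntipodalMinorGluing.lean` (contracted sets ride along inside both members of the complementary pair) run with
gen 18's general level weight (`…AntipodalWeightUpc.lean`: the `q`-factors of the parallel type weights become unit SHIFTS of `w`):
* `FK.apCLW_summand_parallel` — the sixteen-case pointwise identity under a parallel gluing, `FK.apUpcCLW_parallel_eq`,
  `FK.apUpcCLW_parallel_nonneg` (closure of "`0 ≤ apUpcCLW w' (M_i; C_i)` for all `w' ≥ 0`, all monotone `h'`" under parallel composition);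
* `FK.apCLW_summand_series`, `FK.apUpcCLW_series_eq`, `FK.apUpcCLW_series_nonneg` — the same for series composition (a constant shift).
The sibling `…AntipodalMinorWeightUpc.lean` runs the induction over `FK.IsTTSP`.
[cite: Grimmett2006, §1.4 eq. (1.20) (p. 15); §3.8 Thm. (3.90) (pp. 61–62)] [cite: Wagner2006, Thm. 5.8(d), §5.3]
-/

noncomputable section

namespace Summit.CriticalPhenomena.PercolationContinuityZ3.Theorems

namespace FK

open SimpleGraph Literature.Probability.LatticeModels Literature.Probability.Percolation
open scoped Classical

variable {V : Type*} [Fintype V]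

/-! ### Parallel composition -/

section Parallel

variable {E₁ E₂ : Finset (Sym2 V)} {V₁ V₂ : Set V} {s t : V}

set_option linter.unusedSimpArgs false in
/-- **Parallel gluing, the weighted antipodal summand with contracted sets**: with `a_i = k(γ_i∪C_i)+k(γ_iᶜ∪C_i)`, `K = 2|V|`,
`c_i = 1{s↔t in γ_i∪C_i}`, `c̄_i = 1{s↔t in γ_iᶜ∪C_i}`:
`w(a) (c - c̄) x = [(1-c₂)(1-c̄₂) w(a₁+a₂-K) + (1-c₂)c̄₂ w(a₁+a₂+1-K)] (c₁ - c̄₁) x + [(1-c₁)(1-c̄₁) w(a₁+a₂-K) + c₁(1-c̄₁) w(a₁+a₂+1-K)] (c₂ - c̄₂) x`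
(sixteen cases). [cite: Grimmett2006, §3.8 (pp. 61–62)] -/
theorem apCLW_summand_parallel (w : ℕ → ℝ) (hd : Disjoint E₁ E₂) (h₁ : ∀ e ∈ (↑E₁ : Set (Sym2 V)), ∀ z ∈ e, z ∈ V₁)
    (h₂ : ∀ e ∈ (↑E₂ : Set (Sym2 V)), ∀ z ∈ e, z ∈ V₂) (hS : V₁ ∩ V₂ ⊆ {s, t}) (hst : s ≠ t)
    {M₁ M₂ C₁ C₂ γ₁ γ₂ : Finset (Sym2 V)} (hM₁ : M₁ ⊆ E₁) (hM₂ : M₂ ⊆ E₂) (hC₁ : C₁ ⊆ E₁) (hC₂ : C₂ ⊆ E₂)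
    (hγ₁ : γ₁ ⊆ M₁) (hγ₂ : γ₂ ⊆ M₂) (x : ℝ) :
    w (apExpC (M₁ ∪ M₂) (C₁ ∪ C₂) (γ₁ ∪ γ₂)) *
        ((apConn (γ₁ ∪ γ₂ ∪ (C₁ ∪ C₂)) s t - apConn ((M₁ ∪ M₂) \ (γ₁ ∪ γ₂) ∪ (C₁ ∪ C₂)) s t) * x) =
      (((1 - apConn (γ₂ ∪ C₂) s t) * (1 - apConn (M₂ \ γ₂ ∪ C₂) s t)) *
            w (apExpC M₁ C₁ γ₁ + apExpC M₂ C₂ γ₂ - 2 * Fintype.card V) +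
          ((1 - apConn (γ₂ ∪ C₂) s t) * apConn (M₂ \ γ₂ ∪ C₂) s t) *
            w (apExpC M₁ C₁ γ₁ + apExpC M₂ C₂ γ₂ + 1 - 2 * Fintype.card V)) *
        ((apConn (γ₁ ∪ C₁) s t - apConn (M₁ \ γ₁ ∪ C₁) s t) * x) +
      (((1 - apConn (γ₁ ∪ C₁) s t) * (1 - apConn (M₁ \ γ₁ ∪ C₁) s t)) *
            w (apExpC M₁ C₁ γ₁ + apExpC M₂ C₂ γ₂ - 2 * Fintype.card V) +
          (apConn (γ₁ ∪ C₁) s t * (1 - apConn (M₁ \ γ₁ ∪ C₁) s t)) *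
            w (apExpC M₁ C₁ γ₁ + apExpC M₂ C₂ γ₂ + 1 - 2 * Fintype.card V)) *
        ((apConn (γ₂ ∪ C₂) s t - apConn (M₂ \ γ₂ ∪ C₂) s t) * x) := by
  have hdM : Disjoint M₁ M₂ := Finset.disjoint_of_subset_left hM₁ (Finset.disjoint_of_subset_right hM₂ hd)
  have hexp := apExpC_parallel hd h₁ h₂ hS hst hM₁ hM₂ hC₁ hC₂ hγ₁ hγ₂
  have hc : (openGraph (↑(γ₁ ∪ γ₂ ∪ (C₁ ∪ C₂)) : BondConfig V)).Reachable s t ↔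
      (openGraph (↑(γ₁ ∪ C₁) : BondConfig V)).Reachable s t ∨ (openGraph (↑(γ₂ ∪ C₂) : BondConfig V)).Reachable s t := by
    rw [union_union_glue]
    exact reachable_union_parallel h₁ h₂ hS (Finset.union_subset (hγ₁.trans hM₁) hC₁)
      (Finset.union_subset (hγ₂.trans hM₂) hC₂)
  have hcb : (openGraph (↑((M₁ ∪ M₂) \ (γ₁ ∪ γ₂) ∪ (C₁ ∪ C₂)) : BondConfig V)).Reachable s t ↔
      (openGraph (↑(M₁ \ γ₁ ∪ C₁) : BondConfig V)).Reachable s t ∨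
        (openGraph (↑(M₂ \ γ₂ ∪ C₂) : BondConfig V)).Reachable s t := by
    rw [union_sdiff_union hdM hγ₁ hγ₂, union_union_glue]
    exact reachable_union_parallel h₁ h₂ hS (Finset.union_subset (Finset.sdiff_subset.trans hM₁) hC₁)
      (Finset.union_subset (Finset.sdiff_subset.trans hM₂) hC₂)
  unfold apConn
  rw [hc, hcb]
  by_cases a₁ : (openGraph (↑(γ₁ ∪ C₁) : BondConfig V)).Reachable s t <;>
  by_cases a₂ : (openGraph (↑(γ₂ ∪ C₂) : BondConfig V)).Reachable s t <;>
  by_cases b₁ : (openGraph (↑(M₁ \ γ₁ ∪ C₁) : BondConfig V)).Reachable s t <;>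
  by_cases b₂ : (openGraph (↑(M₂ \ γ₂ ∪ C₂) : BondConfig V)).Reachable s t <;>
  simp only [a₁, a₂, b₁, b₂, and_self, and_true, true_and, and_false, false_and, or_self, or_true, true_or, or_false,
    false_or, if_true, if_false, not_false_eq_true, not_true_eq_false, add_zero] at hexp ⊢ <;>
  first
    | (have e : apExpC (M₁ ∪ M₂) (C₁ ∪ C₂) (γ₁ ∪ γ₂) = apExpC M₁ C₁ γ₁ + apExpC M₂ C₂ γ₂ - 2 * Fintype.card V := by omega)
      ; rw [e]; ring
    | (have e : apExpC (M₁ ∪ M₂) (C₁ ∪ C₂) (γ₁ ∪ γ₂) = apExpC M₁ C₁ γ₁ + apExpC M₂ C₂ γ₂ + 1 - 2 * Fintype.card V := by omega)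
      ; rw [e]; ring
    | ring

/-- **Parallel composition of `apUpcCLW`**: for `M = M₁ ⊔ M₂`, `C = C₁ ⊔ C₂` inside a parallel gluing,
`apUpcCLW w (M; C; h) = ∑_{γ₂} [(1-c₂)(1-c̄₂)·apUpcCLW w₀ (M₁; C₁; h(· ∪ γ₂)) + (1-c₂)c̄₂·apUpcCLW w₁ (M₁; C₁; h(· ∪ γ₂))] + (1 ↔ 2)` with
the SHIFTED weights `w₀ n = w(n + a₂ - 2|V|)`, `w₁ n = w(n + a₂ + 1 - 2|V|)`. [cite: Grimmett2006, §3.8 Thm. (3.90) (pp. 61–62)] -/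
theorem apUpcCLW_parallel_eq (w : ℕ → ℝ) (hd : Disjoint E₁ E₂) (h₁ : ∀ e ∈ (↑E₁ : Set (Sym2 V)), ∀ z ∈ e, z ∈ V₁)
    (h₂ : ∀ e ∈ (↑E₂ : Set (Sym2 V)), ∀ z ∈ e, z ∈ V₂) (hS : V₁ ∩ V₂ ⊆ {s, t}) (hst : s ≠ t)
    {M₁ M₂ C₁ C₂ : Finset (Sym2 V)} (hM₁ : M₁ ⊆ E₁) (hM₂ : M₂ ⊆ E₂) (hC₁ : C₁ ⊆ E₁) (hC₂ : C₂ ⊆ E₂)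
    (h : Finset (Sym2 V) → ℝ) :
    apUpcCLW w (M₁ ∪ M₂) (C₁ ∪ C₂) s t h =
      ∑ γ₂ ∈ M₂.powerset,
          (((1 - apConn (γ₂ ∪ C₂) s t) * (1 - apConn (M₂ \ γ₂ ∪ C₂) s t)) *
              apUpcCLW (fun n => w (n + apExpC M₂ C₂ γ₂ - 2 * Fintype.card V)) M₁ C₁ s t (fun γ₁ => h (γ₁ ∪ γ₂)) +
            ((1 - apConn (γ₂ ∪ C₂) s t) * apConn (M₂ \ γ₂ ∪ C₂) s t) *
              apUpcCLW (fun n => w (n + apExpC M₂ C₂ γ₂ + 1 - 2 * Fintype.card V)) M₁ C₁ s t (fun γ₁ => h (γ₁ ∪ γ₂))) +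
        ∑ γ₁ ∈ M₁.powerset,
          (((1 - apConn (γ₁ ∪ C₁) s t) * (1 - apConn (M₁ \ γ₁ ∪ C₁) s t)) *
              apUpcCLW (fun n => w (apExpC M₁ C₁ γ₁ + n - 2 * Fintype.card V)) M₂ C₂ s t (fun γ₂ => h (γ₁ ∪ γ₂)) +
            (apConn (γ₁ ∪ C₁) s t * (1 - apConn (M₁ \ γ₁ ∪ C₁) s t)) *
              apUpcCLW (fun n => w (apExpC M₁ C₁ γ₁ + n + 1 - 2 * Fintype.card V)) M₂ C₂ s t (fun γ₂ => h (γ₁ ∪ γ₂))) := by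
  have hdM : Disjoint M₁ M₂ := Finset.disjoint_of_subset_left hM₁ (Finset.disjoint_of_subset_right hM₂ hd)
  unfold apUpcCLW
  rw [sum_powerset_union_disj hdM]
  simp_rw [Finset.mul_sum, ← Finset.sum_add_distrib]
  rw [Finset.sum_comm (s := M₂.powerset) (t := M₁.powerset), ← Finset.sum_add_distrib]
  refine Finset.sum_congr rfl fun γ₁ hγ₁ => ?_
  rw [← Finset.sum_add_distrib]
  refine Finset.sum_congr rfl fun γ₂ hγ₂ => ?_
  rw [Finset.mem_powerset] at hγ₁ hγ₂
  rw [apCLW_summand_parallel w hd h₁ h₂ hS hst hM₁ hM₂ hC₁ hC₂ hγ₁ hγ₂ (h (γ₁ ∪ γ₂))]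
  ring

/-- **The weighted antipodal up-correlation property with contracted sets is closed under parallel composition.**
[cite: Grimmett2006, §3.8 Thm. (3.90) (pp. 61–62)] -/
theorem apUpcCLW_parallel_nonneg (hd : Disjoint E₁ E₂) (h₁ : ∀ e ∈ (↑E₁ : Set (Sym2 V)), ∀ z ∈ e, z ∈ V₁)
    (h₂ : ∀ e ∈ (↑E₂ : Set (Sym2 V)), ∀ z ∈ e, z ∈ V₂) (hS : V₁ ∩ V₂ ⊆ {s, t}) (hst : s ≠ t)
    {M₁ M₂ C₁ C₂ : Finset (Sym2 V)} (hM₁ : M₁ ⊆ E₁) (hM₂ : M₂ ⊆ E₂) (hC₁ : C₁ ⊆ E₁) (hC₂ : C₂ ⊆ E₂)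
    (ih₁ : ∀ w' : ℕ → ℝ, (∀ n, 0 ≤ w' n) → ∀ h' : Finset (Sym2 V) → ℝ,
      (∀ ⦃A B : Finset (Sym2 V)⦄, A ⊆ B → B ⊆ M₁ → h' A ≤ h' B) → 0 ≤ apUpcCLW w' M₁ C₁ s t h')
    (ih₂ : ∀ w' : ℕ → ℝ, (∀ n, 0 ≤ w' n) → ∀ h' : Finset (Sym2 V) → ℝ,
      (∀ ⦃A B : Finset (Sym2 V)⦄, A ⊆ B → B ⊆ M₂ → h' A ≤ h' B) → 0 ≤ apUpcCLW w' M₂ C₂ s t h')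
    {w : ℕ → ℝ} (hw : ∀ n, 0 ≤ w n)
    {h : Finset (Sym2 V) → ℝ} (hmono : ∀ ⦃A B : Finset (Sym2 V)⦄, A ⊆ B → B ⊆ M₁ ∪ M₂ → h A ≤ h B) :
    0 ≤ apUpcCLW w (M₁ ∪ M₂) (C₁ ∪ C₂) s t h := by
  rw [apUpcCLW_parallel_eq w hd h₁ h₂ hS hst hM₁ hM₂ hC₁ hC₂ h]
  refine add_nonneg (Finset.sum_nonneg fun γ₂ hγ₂ => ?_) (Finset.sum_nonneg fun γ₁ hγ₁ => ?_)
  · rw [Finset.mem_powerset] at hγ₂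
    have hc1 := apConn_le_one (γ₂ ∪ C₂) s t
    have hd0 := apConn_nonneg (M₂ \ γ₂ ∪ C₂) s t
    have hd1 := apConn_le_one (M₂ \ γ₂ ∪ C₂) s t
    have hm : ∀ ⦃A B : Finset (Sym2 V)⦄, A ⊆ B → B ⊆ M₁ → h (A ∪ γ₂) ≤ h (B ∪ γ₂) := fun A B hAB hB =>
      hmono (Finset.union_subset_union hAB le_rfl) (Finset.union_subset_union hB hγ₂)
    exact add_nonneg
      (mul_nonneg (mul_nonneg (sub_nonneg.2 hc1) (sub_nonneg.2 hd1)) (ih₁ _ (fun n => hw _) _ hm))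
      (mul_nonneg (mul_nonneg (sub_nonneg.2 hc1) hd0) (ih₁ _ (fun n => hw _) _ hm))
  · rw [Finset.mem_powerset] at hγ₁
    have hc0 := apConn_nonneg (γ₁ ∪ C₁) s t
    have hc1 := apConn_le_one (γ₁ ∪ C₁) s t
    have hd1 := apConn_le_one (M₁ \ γ₁ ∪ C₁) s t
    have hm : ∀ ⦃A B : Finset (Sym2 V)⦄, A ⊆ B → B ⊆ M₂ → h (γ₁ ∪ A) ≤ h (γ₁ ∪ B) := fun A B hAB hB =>
      hmono (Finset.union_subset_union le_rfl hAB) (Finset.union_subset_union hγ₁ hB)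
    exact add_nonneg
      (mul_nonneg (mul_nonneg (sub_nonneg.2 hc1) (sub_nonneg.2 hd1)) (ih₂ _ (fun n => hw _) _ hm))
      (mul_nonneg (mul_nonneg hc0 (sub_nonneg.2 hd1)) (ih₂ _ (fun n => hw _) _ hm))

end Parallel

/-! ### Series composition -/

section Series

variable {E₁ E₂ : Finset (Sym2 V)} {V₁ V₂ : Set V} {a m b : V}

set_option linter.unusedSimpArgs false in
/-- **Series gluing, the weighted antipodal summand with contracted sets**: `w(a) (c - c̄) x = [c̄₂ (c₁ - c̄₁) + c₁ (c₂ - c̄₂)] w(a₁+a₂-2|V|) x`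
(`c = c₁c₂`, `c̄ = c̄₁c̄₂`). [cite: Grimmett2006, §3.8 (pp. 61–62)] -/
theorem apCLW_summand_series (w : ℕ → ℝ) (hd : Disjoint E₁ E₂) (h₁ : ∀ e ∈ (↑E₁ : Set (Sym2 V)), ∀ z ∈ e, z ∈ V₁)
    (h₂ : ∀ e ∈ (↑E₂ : Set (Sym2 V)), ∀ z ∈ e, z ∈ V₂) (hS : V₁ ∩ V₂ ⊆ {m}) (haV₂ : a ∉ V₂) (hbV₁ : b ∉ V₁)
    (ham : a ≠ m) (hbm : b ≠ m) (hab : a ≠ b)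
    {M₁ M₂ C₁ C₂ γ₁ γ₂ : Finset (Sym2 V)} (hM₁ : M₁ ⊆ E₁) (hM₂ : M₂ ⊆ E₂) (hC₁ : C₁ ⊆ E₁) (hC₂ : C₂ ⊆ E₂)
    (hγ₁ : γ₁ ⊆ M₁) (hγ₂ : γ₂ ⊆ M₂) (x : ℝ) :
    w (apExpC (M₁ ∪ M₂) (C₁ ∪ C₂) (γ₁ ∪ γ₂)) *
        ((apConn (γ₁ ∪ γ₂ ∪ (C₁ ∪ C₂)) a b - apConn ((M₁ ∪ M₂) \ (γ₁ ∪ γ₂) ∪ (C₁ ∪ C₂)) a b) * x) =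
      apConn (M₂ \ γ₂ ∪ C₂) m b * w (apExpC M₁ C₁ γ₁ + apExpC M₂ C₂ γ₂ - 2 * Fintype.card V) *
          ((apConn (γ₁ ∪ C₁) a m - apConn (M₁ \ γ₁ ∪ C₁) a m) * x) +
        apConn (γ₁ ∪ C₁) a m * w (apExpC M₁ C₁ γ₁ + apExpC M₂ C₂ γ₂ - 2 * Fintype.card V) *
          ((apConn (γ₂ ∪ C₂) m b - apConn (M₂ \ γ₂ ∪ C₂) m b) * x) := by
  have hdM : Disjoint M₁ M₂ := Finset.disjoint_of_subset_left hM₁ (Finset.disjoint_of_subset_right hM₂ hd)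
  have hexp := apExpC_series hd h₁ h₂ hS hM₁ hM₂ hC₁ hC₂ hγ₁ hγ₂
  have e : apExpC (M₁ ∪ M₂) (C₁ ∪ C₂) (γ₁ ∪ γ₂) = apExpC M₁ C₁ γ₁ + apExpC M₂ C₂ γ₂ - 2 * Fintype.card V := by omega
  have hc : (openGraph (↑(γ₁ ∪ γ₂ ∪ (C₁ ∪ C₂)) : BondConfig V)).Reachable a b ↔
      (openGraph (↑(γ₁ ∪ C₁) : BondConfig V)).Reachable a m ∧ (openGraph (↑(γ₂ ∪ C₂) : BondConfig V)).Reachable m b := by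
    rw [union_union_glue]
    exact reachable_union_series h₁ h₂ hS haV₂ hbV₁ ham hbm hab (Finset.union_subset (hγ₁.trans hM₁) hC₁)
      (Finset.union_subset (hγ₂.trans hM₂) hC₂)
  have hcb : (openGraph (↑((M₁ ∪ M₂) \ (γ₁ ∪ γ₂) ∪ (C₁ ∪ C₂)) : BondConfig V)).Reachable a b ↔
      (openGraph (↑(M₁ \ γ₁ ∪ C₁) : BondConfig V)).Reachable a m ∧
        (openGraph (↑(M₂ \ γ₂ ∪ C₂) : BondConfig V)).Reachable m b := by
    rw [union_sdiff_union hdM hγ₁ hγ₂, union_union_glue]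
    exact reachable_union_series h₁ h₂ hS haV₂ hbV₁ ham hbm hab
      (Finset.union_subset (Finset.sdiff_subset.trans hM₁) hC₁) (Finset.union_subset (Finset.sdiff_subset.trans hM₂) hC₂)
  rw [e]
  unfold apConn
  rw [hc, hcb]
  by_cases a₁ : (openGraph (↑(γ₁ ∪ C₁) : BondConfig V)).Reachable a m <;>
  by_cases a₂ : (openGraph (↑(γ₂ ∪ C₂) : BondConfig V)).Reachable m b <;>
  by_cases b₁ : (openGraph (↑(M₁ \ γ₁ ∪ C₁) : BondConfig V)).Reachable a m <;>
  by_cases b₂ : (openGraph (↑(M₂ \ γ₂ ∪ C₂) : BondConfig V)).Reachable m b <;>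
  simp only [a₁, a₂, b₁, b₂, and_self, and_true, true_and, and_false, false_and, if_true, if_false,
    not_false_eq_true, not_true_eq_false] <;> ring

/-- **Series composition of `apUpcCLW`**: for `M = M₁ ⊔ M₂`, `C = C₁ ⊔ C₂` inside a series gluing at `m`,
`apUpcCLW w (M; C; a, b; h) = ∑_{γ₂} c̄₂ · apUpcCLW w₀ (M₁; C₁; a, m; h(· ∪ γ₂)) + ∑_{γ₁} c₁ · apUpcCLW w₀' (M₂; C₂; m, b; h(γ₁ ∪ ·))` with the
shifted weights `w₀ n = w(n + a₂ - 2|V|)`, `w₀' n = w(a₁ + n - 2|V|)`. [cite: Grimmett2006, §3.8 Thm. (3.90) (pp. 61–62)] -/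
theorem apUpcCLW_series_eq (w : ℕ → ℝ) (hd : Disjoint E₁ E₂) (h₁ : ∀ e ∈ (↑E₁ : Set (Sym2 V)), ∀ z ∈ e, z ∈ V₁)
    (h₂ : ∀ e ∈ (↑E₂ : Set (Sym2 V)), ∀ z ∈ e, z ∈ V₂) (hS : V₁ ∩ V₂ ⊆ {m}) (haV₂ : a ∉ V₂) (hbV₁ : b ∉ V₁)
    (ham : a ≠ m) (hbm : b ≠ m) (hab : a ≠ b) {M₁ M₂ C₁ C₂ : Finset (Sym2 V)} (hM₁ : M₁ ⊆ E₁) (hM₂ : M₂ ⊆ E₂)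
    (hC₁ : C₁ ⊆ E₁) (hC₂ : C₂ ⊆ E₂) (h : Finset (Sym2 V) → ℝ) :
    apUpcCLW w (M₁ ∪ M₂) (C₁ ∪ C₂) a b h =
      ∑ γ₂ ∈ M₂.powerset, apConn (M₂ \ γ₂ ∪ C₂) m b *
          apUpcCLW (fun n => w (n + apExpC M₂ C₂ γ₂ - 2 * Fintype.card V)) M₁ C₁ a m (fun γ₁ => h (γ₁ ∪ γ₂)) +
        ∑ γ₁ ∈ M₁.powerset, apConn (γ₁ ∪ C₁) a m *
          apUpcCLW (fun n => w (apExpC M₁ C₁ γ₁ + n - 2 * Fintype.card V)) M₂ C₂ m b (fun γ₂ => h (γ₁ ∪ γ₂)) := by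
  have hdM : Disjoint M₁ M₂ := Finset.disjoint_of_subset_left hM₁ (Finset.disjoint_of_subset_right hM₂ hd)
  unfold apUpcCLW
  rw [sum_powerset_union_disj hdM]
  simp_rw [Finset.mul_sum]
  rw [Finset.sum_comm (s := M₂.powerset) (t := M₁.powerset), ← Finset.sum_add_distrib]
  refine Finset.sum_congr rfl fun γ₁ hγ₁ => ?_
  rw [← Finset.sum_add_distrib]
  refine Finset.sum_congr rfl fun γ₂ hγ₂ => ?_
  rw [Finset.mem_powerset] at hγ₁ hγ₂
  rw [apCLW_summand_series w hd h₁ h₂ hS haV₂ hbV₁ ham hbm hab hM₁ hM₂ hC₁ hC₂ hγ₁ hγ₂ (h (γ₁ ∪ γ₂))]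
  ring

/-- **The weighted antipodal up-correlation property with contracted sets is closed under series composition.**
[cite: Grimmett2006, §3.8 Thm. (3.90) (pp. 61–62)] -/
theorem apUpcCLW_series_nonneg (hd : Disjoint E₁ E₂) (h₁ : ∀ e ∈ (↑E₁ : Set (Sym2 V)), ∀ z ∈ e, z ∈ V₁)
    (h₂ : ∀ e ∈ (↑E₂ : Set (Sym2 V)), ∀ z ∈ e, z ∈ V₂) (hS : V₁ ∩ V₂ ⊆ {m}) (haV₂ : a ∉ V₂) (hbV₁ : b ∉ V₁)
    (ham : a ≠ m) (hbm : b ≠ m) (hab : a ≠ b) {M₁ M₂ C₁ C₂ : Finset (Sym2 V)} (hM₁ : M₁ ⊆ E₁) (hM₂ : M₂ ⊆ E₂)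
    (hC₁ : C₁ ⊆ E₁) (hC₂ : C₂ ⊆ E₂)
    (ih₁ : ∀ w' : ℕ → ℝ, (∀ n, 0 ≤ w' n) → ∀ h' : Finset (Sym2 V) → ℝ,
      (∀ ⦃A B : Finset (Sym2 V)⦄, A ⊆ B → B ⊆ M₁ → h' A ≤ h' B) → 0 ≤ apUpcCLW w' M₁ C₁ a m h')
    (ih₂ : ∀ w' : ℕ → ℝ, (∀ n, 0 ≤ w' n) → ∀ h' : Finset (Sym2 V) → ℝ,
      (∀ ⦃A B : Finset (Sym2 V)⦄, A ⊆ B → B ⊆ M₂ → h' A ≤ h' B) → 0 ≤ apUpcCLW w' M₂ C₂ m b h')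
    {w : ℕ → ℝ} (hw : ∀ n, 0 ≤ w n)
    {h : Finset (Sym2 V) → ℝ} (hmono : ∀ ⦃A B : Finset (Sym2 V)⦄, A ⊆ B → B ⊆ M₁ ∪ M₂ → h A ≤ h B) :
    0 ≤ apUpcCLW w (M₁ ∪ M₂) (C₁ ∪ C₂) a b h := by
  rw [apUpcCLW_series_eq w hd h₁ h₂ hS haV₂ hbV₁ ham hbm hab hM₁ hM₂ hC₁ hC₂ h]
  refine add_nonneg (Finset.sum_nonneg fun γ₂ hγ₂ => ?_) (Finset.sum_nonneg fun γ₁ hγ₁ => ?_)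
  · rw [Finset.mem_powerset] at hγ₂
    refine mul_nonneg (apConn_nonneg _ _ _) (ih₁ _ (fun n => hw _) _ fun A B hAB hB => ?_)
    exact hmono (Finset.union_subset_union hAB le_rfl) (Finset.union_subset_union hB hγ₂)
  · rw [Finset.mem_powerset] at hγ₁
    refine mul_nonneg (apConn_nonneg _ _ _) (ih₂ _ (fun n => hw _) _ fun A B hAB hB => ?_)
    exact hmono (Finset.union_subset_union le_rfl hAB) (Finset.union_subset_union hγ₁ hB)

end Series

end FK

end Summit.CriticalPhenomena.PercolationContinuityZ3.Theorems

end
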